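import Mathlib
import Summits.NavierStokesRegularity.NavierStokesRegularity.Theorems.FilamentSkeletonRssStadiumContourFamily
import Summits.NavierStokesRegularity.NavierStokesRegularity.Theorems.FilamentSkeletonRssStadiumSourceRegionTwo
import Summits.NavierStokesRegularity.NavierStokesRegularity.Theorems.FilamentSkeletonRssStadiumConstants

/-!
# Freezing the height of the retyped own-filament contour (`TangentSkeletonNearStraightL`, stmt-NavierStokesRegularity-23320, registered stub
# `stub_stripPropagation` — the `hfreeze` half of blueprint item R4′ of `DIAG-addendum2-landed-g2.md`)

Concrete geometry of the retype: `16 h ≤ hs`, output stadium `S₁₆ = {|Im| < h, |Re − c| < L + h}`, plateau `|Re ζ − c| ≤ P := L + 8h` at the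
target's height, two fixed connectors at `c ± P`, disc ratio `8`, `M = 2`, `0 ≤ Rb ≤ 1/2`.  For two targets `z₀, z ∈ S₁₆` (the contour pieces are
evaluated for the SAME target `z`; only the HEIGHT is frozen at `Im z₀`) with `|Im z − Im z₀| < δ`, `δ ≤ (2/7) r₀`, `12(r₀ + δ)² ≤ κΛ⁻¹/4`:
  `Φ(Im z₀, z) = Φ(Im z, z)`, `Φ(y, z) := ∫_{c−P}^{c+P} K(z, σ+iy) dσ − i•∫_0^y K(z, c+P+is) ds + i•∫_0^y K(z, c−P+is) ds`
(`contour_freeze`): Theorems.StadiumContourFamily.plateau_connectors_eq with the source-holomorphy region of Theorems.StadiumSourceRegionTwo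
(band of half-height `δ` ∪ slope region `r₁ = 7h`, `m = 2/7`), whose numerical hypotheses are Theorems.StadiumConstants.ratio8_hA / ratio8_hC; the
rectangle `[c−P, c+P] × [Im z₀, Im z]` lies in the band and the connectors in the slope region (`|Re z − (c ± P)| > 7h`, `|Im z − s| < 2h`).
HONEST FRAMING: bookkeeping for a HYPOTHETICAL filament skeleton on the NEGATIVE side of a MODEL route; nothing here bears on Navier–Stokes regularity or
blow-up.  `--supports stmt-NavierStokesRegularity-23320`.
-/

set_option linter.dupNamespace false

noncomputable section

namespace Summit.NavierStokesRegularity.NavierStokesRegularity.Theorems.StadiumContourFreeze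

open Set Metric MeasureTheory Complex
open scoped InnerProductSpace Matrix
open Summit.NavierStokesRegularity.NavierStokesRegularity.Theorems.StadiumContourFamily
open Summit.NavierStokesRegularity.NavierStokesRegularity.Theorems.StadiumSourceRegionTwo
open Summit.NavierStokesRegularity.NavierStokesRegularity.Theorems.StadiumConstants

/-- `|s| ≤ max |y₀| |y₁|` on `uIcc 0 y₀ ∪ uIcc 0 y₁`. [folklore] -/
theorem abs_le_of_mem_union_uIcc {s y₀ y₁ : ℝ} (hs : s ∈ Set.uIcc 0 y₀ ∪ Set.uIcc 0 y₁) : |s| ≤ max |y₀| |y₁| := by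
  have key : ∀ {u : ℝ}, s ∈ Set.uIcc 0 u → |s| ≤ |u| := by
    intro u hu
    rcases le_total 0 u with h | h
    · rw [uIcc_of_le h] at hu; rw [abs_of_nonneg hu.1, abs_of_nonneg h]; exact hu.2
    · rw [uIcc_of_ge h] at hu; rw [abs_of_nonpos hu.2, abs_of_nonpos h]; linarith [hu.1]
  rcases hs with h | h
  · exact (key h).trans (le_max_left _ _)
  · exact (key h).trans (le_max_right _ _)

/-- **Freezing the height.**  See the module docstring. [folklore] -/
theorem contour_freeze {hs L cc Rb h r₀ δ κ Λ : ℝ} {F : ℂ → (Fin 3 → ℂ)} {G : ℂ → ℂ}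
    (hF : DifferentiableOn ℂ F {z : ℂ | |z.im| < hs ∧ |z.re - cc| < L + hs})
    (hunit : ∀ w ∈ {z : ℂ | |z.im| < hs ∧ |z.re - cc| < L + hs}, ∑ i, (deriv F w i) ^ 2 = 1)
    (hM : ∀ z ∈ {z : ℂ | |z.im| < hs ∧ |z.re - cc| < L + hs}, ‖deriv F z‖ ≤ 2)
    {X : ℝ → EuclideanSpace ℝ (Fin 3)} (hX : Differentiable ℝ X) (hXu : ∀ τ, ‖deriv X τ‖ = 1)
    (hRb0 : 0 ≤ Rb) (hRb : Rb ≤ 1 / 2) (hosc : ∀ τ σ, ‖deriv X τ - deriv X σ‖ ≤ Rb)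
    (hFX : ∀ r : ℝ, (r : ℂ) ∈ {z : ℂ | |z.im| < hs ∧ |z.re - cc| < L + hs} →
      F r = fun i => ((⟪X r, EuclideanSpace.single i (1:ℝ)⟫_ℝ : ℝ) : ℂ))
    (hG : DifferentiableOn ℂ G {z : ℂ | |z.im| < hs ∧ |z.re - cc| < L + hs})
    (hGre : ∀ w ∈ {z : ℂ | |z.im| < hs ∧ |z.re - cc| < L + hs}, Λ⁻¹ / 2 ≤ (G w).re)
    (hκ : 0 < κ) (hΛ : 0 < Λ) (hh : 0 < h) (h16 : 16 * h ≤ hs) (hL : 0 ≤ L)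
    {z₀ z : ℂ} (hz₀ : |z₀.im| < h ∧ |z₀.re - cc| < L + h) (hz : |z.im| < h ∧ |z.re - cc| < L + h)
    (hr₀ : 0 < r₀) (hδ : |z.im - z₀.im| < δ) (hδm : δ ≤ 2 / 7 * r₀) (hsmall : 3 * 2 ^ 2 * (r₀ + δ) ^ 2 ≤ κ * Λ⁻¹ / 4) :
    let K : ℂ → (Fin 3 → ℂ) := fun ζ => (((∑ i, (F z i - F ζ i) ^ 2) + (κ : ℂ) * G ζ) ^ ((3:ℂ) / 2))⁻¹ •
        (deriv F ζ ⨯₃ (fun i => F z i - F ζ i))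
    (∫ σ in (cc - (L + 8 * h))..(cc + (L + 8 * h)), K ((σ : ℂ) + (z₀.im : ℂ) * I)) -
        I • (∫ s in (0:ℝ)..z₀.im, K (((cc + (L + 8 * h) : ℝ) : ℂ) + (s : ℂ) * I)) +
        I • (∫ s in (0:ℝ)..z₀.im, K (((cc - (L + 8 * h) : ℝ) : ℂ) + (s : ℂ) * I)) =
      (∫ σ in (cc - (L + 8 * h))..(cc + (L + 8 * h)), K ((σ : ℂ) + (z.im : ℂ) * I)) -
        I • (∫ s in (0:ℝ)..z.im, K (((cc + (L + 8 * h) : ℝ) : ℂ) + (s : ℂ) * I)) +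
        I • (∫ s in (0:ℝ)..z.im, K (((cc - (L + 8 * h) : ℝ) : ℂ) + (s : ℂ) * I)) := by
  intro K
  set P : ℝ := L + 8 * h with hP
  -- the source-holomorphy region of the target `z` (band δ, slope region r₁ = 7h, m = 2/7, ratio 8)
  have hzS : z ∈ {z : ℂ | |z.im| < hs ∧ |z.re - cc| < L + hs} := ⟨by linarith [hz.1], by linarith [hz.2]⟩
  have hzfit : 8 * |z.im| < hs := by linarith [hz.1]
  have hzfit' : |z.re - cc| + 8 * |z.im| < L + hs := by linarith [hz.1, hz.2]
  have hA := ratio8_hA hRb0 hRb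
  have hC := ratio8_hC hRb0 hRb (by norm_num : (0:ℝ) ≤ 2 / 7) le_rfl
  have hreg := kernel_source_differentiableOn_region₂ (n := 8) (M := 2) (m := 2 / 7) hF hunit hM hX hXu hosc hFX hG hGre (by norm_num) hκ hΛ
    hzS hzfit hzfit' (by norm_num) (by norm_num) hr₀ (r₁ := 7 * h) (by positivity) hδm hsmall hA hC
  -- region membership helpers
  have band_mem : ∀ ζ : ℂ, |ζ.re - cc| ≤ P → |ζ.im| < h → |z.im - ζ.im| < δ →
      ζ ∈ {ζ : ℂ | (|ζ.im| < hs ∧ |ζ.re - cc| < L + hs) ∧ 8 * |ζ.im| < hs ∧ |ζ.re - cc| + 8 * |ζ.im| < L + hs ∧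
        (|z.im - ζ.im| < δ ∨ (7 * h < |z.re - ζ.re| ∧ |z.im - ζ.im| < 2 / 7 * (7 * h)))} := by
    intro ζ h1 h2 h3
    refine ⟨⟨by linarith, by linarith⟩, by linarith, by linarith, Or.inl h3⟩
  have slope_mem : ∀ ζ : ℂ, |ζ.re - cc| = P → |ζ.im| < h →
      ζ ∈ {ζ : ℂ | (|ζ.im| < hs ∧ |ζ.re - cc| < L + hs) ∧ 8 * |ζ.im| < hs ∧ |ζ.re - cc| + 8 * |ζ.im| < L + hs ∧
        (|z.im - ζ.im| < δ ∨ (7 * h < |z.re - ζ.re| ∧ |z.im - ζ.im| < 2 / 7 * (7 * h)))} := by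
    intro ζ h1 h2
    refine ⟨⟨by linarith, by linarith⟩, by linarith, by linarith, Or.inr ⟨?_, ?_⟩⟩
    · -- `|z.re − ζ.re| ≥ |ζ.re − cc| − |z.re − cc| > P − (L + h) = 7h`
      have := abs_sub_abs_le_abs_sub (ζ.re - cc) (z.re - cc)
      have e : ζ.re - cc - (z.re - cc) = -(z.re - ζ.re) := by ring
      rw [e, abs_neg] at this
      linarith [hz.2]
    · have := abs_sub (z.im) (ζ.im)
      linarith [hz.1]
  -- rectangle ⊆ region (band)
  have hrect : (Set.uIcc (cc - P) (cc + P) ×ℂ Set.uIcc z₀.im z.im) ⊆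
      {ζ : ℂ | (|ζ.im| < hs ∧ |ζ.re - cc| < L + hs) ∧ 8 * |ζ.im| < hs ∧ |ζ.re - cc| + 8 * |ζ.im| < L + hs ∧
        (|z.im - ζ.im| < δ ∨ (7 * h < |z.re - ζ.re| ∧ |z.im - ζ.im| < 2 / 7 * (7 * h)))} := by
    intro ζ hζ
    rw [mem_reProdIm] at hζ
    obtain ⟨hre, him⟩ := hζ
    have hPpos : 0 < P := by rw [hP]; linarith
    rw [uIcc_of_le (by linarith : cc - P ≤ cc + P)] at hre
    have h1 : |ζ.re - cc| ≤ P := abs_le.2 ⟨by linarith [hre.1], by linarith [hre.2]⟩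
    -- Im ζ between Im z₀ and Im z
    have h2 : |ζ.im| < h ∧ |z.im - ζ.im| < δ := by
      rcases le_total z₀.im z.im with hle | hle
      · rw [uIcc_of_le hle] at him
        constructor
        · rw [abs_lt] at hz hz₀ ⊢; constructor <;> linarith [him.1, him.2, hz.1.1, hz.1.2, hz₀.1.1, hz₀.1.2]
        · rw [abs_lt] at hδ ⊢; constructor <;> linarith [him.1, him.2, hδ.1, hδ.2]
      · rw [uIcc_of_ge hle] at him
        constructor
        · rw [abs_lt] at hz hz₀ ⊢; constructor <;> linarith [him.1, him.2, hz.1.1, hz.1.2, hz₀.1.1, hz₀.1.2]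
        · rw [abs_lt] at hδ ⊢; constructor <;> linarith [him.1, him.2, hδ.1, hδ.2]
    exact band_mem ζ h1 h2.1 h2.2
  -- connectors ⊆ region (slope)
  have hmax : max |z₀.im| |z.im| < h := max_lt hz₀.1 hz.1
  have hconn : ∀ x₀ : ℝ, |x₀ - cc| = P → ∀ s ∈ Set.uIcc 0 z₀.im ∪ Set.uIcc 0 z.im,
      ((x₀ : ℂ) + (s : ℂ) * I) ∈ {ζ : ℂ | (|ζ.im| < hs ∧ |ζ.re - cc| < L + hs) ∧ 8 * |ζ.im| < hs ∧ |ζ.re - cc| + 8 * |ζ.im| < L + hs ∧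
        (|z.im - ζ.im| < δ ∨ (7 * h < |z.re - ζ.re| ∧ |z.im - ζ.im| < 2 / 7 * (7 * h)))} := by
    intro x₀ hx₀ s hs'
    have hsabs : |s| < h := lt_of_le_of_lt (abs_le_of_mem_union_uIcc hs') hmax
    apply slope_mem
    · simpa using hx₀
    · simpa using hsabs
  have hPa : |cc - P - cc| = P := by
    have hPpos : 0 < P := by rw [hP]; linarith
    rw [show cc - P - cc = -P by ring, abs_neg, abs_of_pos hPpos]
  have hPb : |cc + P - cc| = P := by
    have hPpos : 0 < P := by rw [hP]; linarith
    rw [show cc + P - cc = P by ring, abs_of_pos hPpos]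
  have hres := plateau_connectors_eq (h := K) hreg hrect (hconn (cc - P) hPa) (hconn (cc + P) hPb)
  simpa [hP] using hres

end Summit.NavierStokesRegularity.NavierStokesRegularity.Theorems.StadiumContourFreeze

end
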